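import Summits.BirchSwinnertonDyer.Rank1Residual.Additive.CongruentPartnerBudgetSchemaHolds
import Summits.BirchSwinnertonDyer.Rank1Residual.AdditivePotMult.PotMultX3BranchPAdicValIdentityRouteG
import HarnessLib

/-!
# X3♯(M) Route-G ends with the budget READ OFF the schema: `hbud` ↦ (Greenberg 1999 Prop. 4.14 record
# BY NAME + `p ∤ #E(ℚ)_tors` + the ONE residual count `ResidualSelmerRankGeAt p W n₀`) — rank `0`
# (`BSD(E,p)`), rank `1` (typed `p`-adic Gross–Zagier capstone; census-column valuation headline),
# every odd `p` and `p = 3` (cell `b2b-bsdres`, team n1011, seat p12 (gen 3); the X3♯(M) twin of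
# n1011-p06's X3♯(G-ord) schema sequel `CongruentPartnerMainConjectureX3GordSchema.lean`; budget schema
# by cc-typer-2 (`CongruentPartnerBudgetSchema.lean`), folklore binders (L1)/(L2) discharged in
# `CongruentPartnerBudgetSchemaHolds.lean`)

HONEST FRAMING (cell `b2b-bsdres`, run/shared/lean/b2b/bsd-rank1-residual/, verbatim in every
file): the goal of the cell is to DELETE the COMBINATION-SHAPED residual classes of the
Birch–Swinnerton-Dyer formula for ALL analytic-rank `≤ 1` elliptic curves over `ℚ` — "full BSD
formula for every rank `≤ 1` curve in class `C`" assembled STRICTLY from published theorems — so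
that the rank-`≤ 1` remainder becomes exactly the CONSTRUCTION-SHAPED classes, which are TYPED
(missing-input `Prop`s), NOT attempted. This is not "finishing BSD". Team n1011 (RESIDUAL-MAP §I
N10 (M) / O7-ord, X3♯(M) share: X3 ∧ pot-mult(p), `E[p]` REDUCIBLE): research route on
CONSTRUCTION-SHAPED items; labels and marks UNCHANGED; nothing booked; NO Literature fact minted; NO
definition; THEOREMS ONLY (one-liners over this seat's X3♯(M) ends BY NAME). Named facts as
HYPOTHESES: `hW16` (Wuthrich 2014 Thm. 16), `hDel`/`hDelX` (Delbourgo 1998 Prop. 4), `hDelM`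
(Delbourgo 2002 (M)), `hPal`, GZK, modularity, AND NOW `h414` (Greenberg 1999 Prop. 4.14 record
`Greenberg1999.prop414_noFiniteSubmodule_of_not_dvd_torsionOrder`, PUBLISHED, any reduction type).
Per-pair inputs OUTSIDE the kernel, unchanged in tier: the census record at index `n₀`
(CERTIFICATE-EVIDENCE), the column `MultCoeffValAt W p 1 v₁` where used, and the ONE residual count
`ResidualSelmerRankGeAt p W n₀` (`p^{n₀} ≤ #Sel_{p^∞}(E/ℚ_∞)[p]`; flag `X3-budget-unprinted`: NO
printed discharge on reducible rows — EPW 2006 Cor. 3.2.5 is irreducible-only; ROUTE-2 II.13.2 /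
II.15.2). Debt 0.

## What (ROUTE-2 II.15.2 in kernel form on the X3♯(M) rows)

With (L1)/(L2) theorems, `BudgetLeLambdaAt p W n₀ ⟸ h414 ∧ p ∤ #E(ℚ)_tors ∧ ResidualSelmerRankGeAt p W n₀`
(`budgetLeLambdaAt_of_prop414_of_residualSurj''`). Substituted into this seat's X3♯(M) ends:
* §1 rank `0`: `ClassX3M.bsdp_rankZero_of_wuthrichHalf_of_firstUnitIndex_of_prop414_of_residualSurj`
  (every odd `p`, `hPal` for `p ≡ 1 (4)`), `…_odd` (Pal-free, `p ≡ 3 (4)`), `…three…` (`p = 3`).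
* §2 rank `1`: `ClassX3M.bsdp_iff_forall_branchPAdicGrossZagierMultAt_of_wuthrichHalf_of_firstUnitIndex_of_prop414_of_residualSurj`
  (`BSD(E,p) ⟺ ∀ (B)-data, typed (M) p-adic GZ`) and the census-column valuation headline
  `ClassX3M.bsdp_iff_padicVal_rankOne_of_wuthrichHalf_of_firstUnitIndex_of_multCoeffValAt_of_prop414_of_residualSurj`
  (`BSD(E,p) ⟺ ord_p q + ord_p Reg_p(E,Dh) = 1 + v₁`), + `p = 3` form.
OUTPUT tier unchanged (EVIDENCE-conditional per pair on the record + the residual count); X3 / O7-ord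
stay CONSTRUCTION-SHAPED; nothing booked.

References: C. Wuthrich, Doc. Math. 19 (2014) Thm. 16 [Wuthrich2014]; D. Delbourgo, Compos. Math.
1998 Prop. 4 [Delbourgo1998]; D. Delbourgo, J. Number Theory 95 (2002) Thm. (A)/(B) [Delbourgo2002];
R. Greenberg, LNM 1716 (1999) Prop. 4.14 [GreenbergLNM1716]; Y. Hachimori, K. Matsuno, Proc. AMS 128
(2000) Cor. (i) [HachimoriMatsuno2000]; A. Pal, Proc. AMS 140 (2012) Thm. 3.2 [Pal2012]; R. L.
Miller, LMS J. Comput. Math. 14 (2011) Def. 1.1 [Miller2011LMS].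
-/

set_option autoImplicit false

noncomputable section

open scoped Classical MatrixGroups ModularForm NumberField

namespace Summit.BirchSwinnertonDyer.Rank1Residual.AdditivePotMult

open CongruenceSubgroup WeierstrassCurve NumberField Literature.NumberTheory.EllipticCurves
  Literature.NumberTheory.EllipticCurves.ModularForms
  Literature.NumberTheory.EllipticCurves.Rank1Residual
  Literature.NumberTheory.EllipticCurves.Rank1Residual.Typed
  Literature.NumberTheory.EllipticCurves.Delbourgo2002
  Literature.NumberTheory.GaloisRepresentations
  Summit.BirchSwinnertonDyer.Rank1Residual.Additive
  Summit.BirchSwinnertonDyer.Rank1Residual.Additive.CensusQ6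
  IsDedekindDomain

variable {W : WeierstrassCurve ℚ} [W.IsElliptic] [W.IsGloballyMinimal] {p : ℕ} [hp : Fact p.Prime]

/-! ### §1 Rank `0`: `BSD(E,p)` on X3♯(M) from the record + Prop. 4.14 + the residual count -/

/-- **X3♯(M) ∧ `r_an = 0`, EVERY odd `p`: `BSD(E,p)`** from Wuthrich's half `hW16`, the Q6 record at
index `n₀` (parity pair), the Greenberg 1999 Prop. 4.14 record `h414` with `p ∤ #E(ℚ)_tors`, and the
ONE residual count `ResidualSelmerRankGeAt p W n₀` (flag `X3-budget-unprinted`) — this seat's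
`…_of_budget` end with the budget supplied by `budgetLeLambdaAt_of_prop414_of_residualSurj''`.
[cite: Wuthrich2014, Thm. 16 (p. 397)] [cite: Delbourgo1998, Prop. 4 (p. 144)]
[cite: GreenbergLNM1716, Prop. 4.14 (§4)] [cite: Pal2012, Thm. 3.2] [cite: Miller2011LMS, Def. 1.1] -/
theorem ClassX3M.bsdp_rankZero_of_wuthrichHalf_of_firstUnitIndex_of_prop414_of_residualSurj
    (hW16 : Wuthrich2014.thm16_halfEigenCharIdeal_dvd_cyclotomicPrime)
    (hDel : Delbourgo1998.prop4_rankZero_pow_dvd_constantCoeff)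
    (hDelX : Delbourgo1998.prop4_rankZero_constantCoeff_eq_unit_mul_of_potMult)
    (hPal : Pal2012.thm32_sqrt_mul_realPeriodRat_twist_eq_of_prime_one_mod_four)
    (h414 : Greenberg1999.prop414_noFiniteSubmodule_of_not_dvd_torsionOrder)
    (hGZK : rank_eq_analyticRank_of_analyticRank_le_one) (hmod : hasEntireLFunction_rat)
    (hmodD : nonempty_modularParametrizationData)
    (hX : ClassX3M W p) (hr : W.analyticRank = 0) (htors : ¬ p ∣ W.torsionOrder) {n₀ : ℕ}
    (hrec : (p % 4 = 1 → MultFirstUnitIndexAt W p n₀) ∧ (p % 4 = 3 → MultOddFirstUnitIndexAt W p n₀))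
    (hres : ResidualSelmerRankGeAt p W n₀) : BSDp W p :=
  hX.bsdp_rankZero_of_wuthrichHalf_of_firstUnitIndex_of_budget hW16 hDel hDelX hPal hGZK hmod hmodD hr
    hrec (budgetLeLambdaAt_of_prop414_of_residualSurj'' p h414 htors hres)

/-- **Pal-free odd form, X3♯(M) ∧ `r_an = 0`, `p ≡ 3 (mod 4)` (`p = 3` included): `BSD(E,p)`** from
`hW16`, the odd-branch record `MultOddFirstUnitIndexAt W p n₀`, `h414` + `p ∤ #E(ℚ)_tors` and
`ResidualSelmerRankGeAt p W n₀`. [cite: Wuthrich2014, Thm. 16 (p. 397)] [cite: Delbourgo1998, Prop. 4 (p. 144)]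
[cite: GreenbergLNM1716, Prop. 4.14 (§4)] [cite: Miller2011LMS, Def. 1.1] -/
theorem ClassX3M.bsdp_rankZero_of_wuthrichHalf_of_firstUnitIndex_of_prop414_of_residualSurj_odd
    (hW16 : Wuthrich2014.thm16_halfEigenCharIdeal_dvd_cyclotomicPrime)
    (hDel : Delbourgo1998.prop4_rankZero_pow_dvd_constantCoeff)
    (hDelX : Delbourgo1998.prop4_rankZero_constantCoeff_eq_unit_mul_of_potMult)
    (h414 : Greenberg1999.prop414_noFiniteSubmodule_of_not_dvd_torsionOrder)
    (hGZK : rank_eq_analyticRank_of_analyticRank_le_one) (hmod : hasEntireLFunction_rat)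
    (hmodD : nonempty_modularParametrizationData)
    (hX : ClassX3M W p) (hp4 : p % 4 = 3) (hr : W.analyticRank = 0) (htors : ¬ p ∣ W.torsionOrder)
    {n₀ : ℕ} (hrec : MultOddFirstUnitIndexAt W p n₀) (hres : ResidualSelmerRankGeAt p W n₀) :
    BSDp W p :=
  hX.bsdp_rankZero_of_wuthrichHalf_of_firstUnitIndex_of_budget_odd hW16 hDel hDelX hGZK hmod hmodD hp4 hr
    hrec (budgetLeLambdaAt_of_prop414_of_residualSurj'' p h414 htors hres)

/-- **`p = 3`: X3♯(M) ∧ `r_an = 0` at `3` (the (M)@3 share of N11 / N10 (M))** — `BSD(E,3)` from `hW16`,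
the record `MultOddFirstUnitIndexAt W 3 n₀`, `h414` + `3 ∤ #E(ℚ)_tors` and `ResidualSelmerRankGeAt 3 W n₀`.
[cite: Wuthrich2014, Thm. 16 (p. 397)] [cite: Delbourgo1998, Prop. 4 (p. 144)] [cite: GreenbergLNM1716, Prop. 4.14 (§4)] -/
theorem ClassX3M.bsdp_three_rankZero_of_wuthrichHalf_of_firstUnitIndex_of_prop414_of_residualSurj
    [Fact (Nat.Prime 3)] {W : WeierstrassCurve ℚ} [W.IsElliptic] [W.IsGloballyMinimal]
    (hW16 : Wuthrich2014.thm16_halfEigenCharIdeal_dvd_cyclotomicPrime)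
    (hDel : Delbourgo1998.prop4_rankZero_pow_dvd_constantCoeff)
    (hDelX : Delbourgo1998.prop4_rankZero_constantCoeff_eq_unit_mul_of_potMult)
    (h414 : Greenberg1999.prop414_noFiniteSubmodule_of_not_dvd_torsionOrder)
    (hGZK : rank_eq_analyticRank_of_analyticRank_le_one) (hmod : hasEntireLFunction_rat)
    (hmodD : nonempty_modularParametrizationData)
    (hX : ClassX3M W 3) (hr : W.analyticRank = 0) (htors : ¬ 3 ∣ W.torsionOrder) {n₀ : ℕ}
    (hrec : MultOddFirstUnitIndexAt W 3 n₀) (hres : ResidualSelmerRankGeAt 3 W n₀) : BSDp W 3 :=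
  hX.bsdp_rankZero_of_wuthrichHalf_of_firstUnitIndex_of_prop414_of_residualSurj_odd hW16 hDel hDelX h414
    hGZK hmod hmodD (by decide) hr htors hrec hres

/-! ### §2 Rank `1`: the Route-G capstone and the census-column valuation headline, budget off the schema -/

/-- **CAPSTONE, X3♯(M) ∧ `r_an = 1`, EVERY odd `p`: `BSD(E,p) ⟺ ∀ (B)-data, typed (M) p-adic
Gross–Zagier`** — this seat's `…_of_firstUnitIndex_of_budget` capstone (p258076) with the budget from
`h414` + `p ∤ #E(ℚ)_tors` + `ResidualSelmerRankGeAt p W n₀`; the one-sided bit `hne` unchanged.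
[cite: Wuthrich2014, Thm. 16 (p. 397)] [cite: Delbourgo2002, Theorem (A), (B) (p. 40)]
[cite: GreenbergLNM1716, Prop. 4.14 (§4)] [cite: Miller2011LMS, Def. 1.1] -/
theorem ClassX3M.bsdp_iff_forall_branchPAdicGrossZagierMultAt_of_wuthrichHalf_of_firstUnitIndex_of_prop414_of_residualSurj
    (hDelM : Delbourgo2002.mainTheorem_potMult)
    (hW16 : Wuthrich2014.thm16_halfEigenCharIdeal_dvd_cyclotomicPrime)
    (h414 : Greenberg1999.prop414_noFiniteSubmodule_of_not_dvd_torsionOrder)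
    (hmod : hasEntireLFunction_rat) (hmodD : nonempty_modularParametrizationData)
    (hGZK : rank_eq_analyticRank_of_analyticRank_le_one)
    (hX : ClassX3M W p) (hr : W.analyticRank = 1) (htors : ¬ p ∣ W.torsionOrder) {n₀ : ℕ}
    (hrec : (p % 4 = 1 → MultFirstUnitIndexAt W p n₀) ∧ (p % 4 = 3 → MultOddFirstUnitIndexAt W p n₀))
    (hres : ResidualSelmerRankGeAt p W n₀)
    (hne : ∀ (V : WeierstrassCurve ℚ) [V.IsElliptic] [V.IsGloballyMinimal] (C : VariableChange ℚ),
      Mult V p → C • V.quadraticTwist ((-1 : ℚ) ^ (p / 2) * p) = W →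
      ∀ {N : ℕ} [NeZero N] (f : CuspForm (Gamma0 N) 2), IsNewformOf V f → ∀ (ap : ℤ), cuspCoeff f p = ap →
      ∀ ϖ : ℚ, (if Even (p / 2) then (ϖ : ℝ) * V.realPeriodRat = plusPeriod f
          else (ϖ : ℝ) * V.imaginaryPeriodRat = minusPeriod f) →
        PowerSeries.coeff 1 (PowerSeries.C (ϖ : ℚ_[p]) *
            (if Even (p / 2) then padicLFunctionPlusBranchMult f (ap : ℚ_[p]) (p / 2)
              else padicLFunctionMinusBranchMult f (ap : ℚ_[p]) (p / 2))) ≠ 0) :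
    BSDp W p ↔
      ∀ Dh : PAdicHeightData W p, LeadingTermClauses W p Dh → BranchPAdicGrossZagierMultAt W p Dh :=
  hX.bsdp_iff_forall_branchPAdicGrossZagierMultAt_of_wuthrichHalf_of_firstUnitIndex_of_budget hDelM hW16
    hmod hmodD hGZK hr hrec (budgetLeLambdaAt_of_prop414_of_residualSurj'' p h414 htors hres) hne

/-- **HEADLINE with the census COLUMN, budget off the schema (X3♯(M) ∧ `r_an = 1`, EVERY odd `p`):
`BSD(E,p) ⟺ ord_p q + ord_p Reg_p(E,Dh) = 1 + v₁`** for every (B)-datum `Dh` (`L'(E,1) = q·Ω_E·Reg_∞(E)`,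
`v₁` = census-ctyper1's column `MultCoeffValAt W p 1 v₁`), from `hW16`, the record at `n₀`, `h414` +
`p ∤ #E(ℚ)_tors` and `ResidualSelmerRankGeAt p W n₀`. [cite: Wuthrich2014, Thm. 16 (p. 397)]
[cite: Delbourgo2002, Theorem (B) (p. 40)] [cite: GreenbergLNM1716, Prop. 4.14 (§4)] [cite: Miller2011LMS, Def. 1.1] -/
theorem ClassX3M.bsdp_iff_padicVal_rankOne_of_wuthrichHalf_of_firstUnitIndex_of_multCoeffValAt_of_prop414_of_residualSurj
    (hW16 : Wuthrich2014.thm16_halfEigenCharIdeal_dvd_cyclotomicPrime)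
    (h414 : Greenberg1999.prop414_noFiniteSubmodule_of_not_dvd_torsionOrder)
    (hmodD : nonempty_modularParametrizationData)
    (hGZK : rank_eq_analyticRank_of_analyticRank_le_one) (hmod : hasEntireLFunction_rat)
    (hX : ClassX3M W p) (hr : W.analyticRank = 1) (htors : ¬ p ∣ W.torsionOrder) {n₀ : ℕ}
    (hrec : (p % 4 = 1 → MultFirstUnitIndexAt W p n₀) ∧ (p % 4 = 3 → MultOddFirstUnitIndexAt W p n₀))
    (hres : ResidualSelmerRankGeAt p W n₀) {v₁ : ℤ} (hv : MultCoeffValAt W p 1 v₁)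
    {Dh : PAdicHeightData W p} (hB : LeadingTermClauses W p Dh)
    {q : ℚ} (hLq : W.leadingLCoeff = (q : ℂ) * (W.realPeriodRat : ℂ) * (W.regulator : ℂ)) :
    BSDp W p ↔ padicValRat p q + (padicRegulator Dh).valuation = 1 + v₁ :=
  hX.bsdp_iff_padicVal_rankOne_of_wuthrichHalf_of_firstUnitIndex_of_multCoeffValAt_of_budget hW16 hmodD
    hGZK hmod hr hrec (budgetLeLambdaAt_of_prop414_of_residualSurj'' p h414 htors hres) hv hB hLq

/-- **`p = 3` HEADLINE with the column, budget off the schema**: X3♯(M) ∧ `r_an = 1` at `3`, record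
`MultOddFirstUnitIndexAt W 3 n₀`, column `MultCoeffValAt W 3 1 v₁`, `h414` + `3 ∤ #E(ℚ)_tors`,
`ResidualSelmerRankGeAt 3 W n₀` ⟹ `BSD(E,3) ⟺ ord_3 q + ord_3 Reg_3(E,Dh) = 1 + v₁`.
[cite: Wuthrich2014, Thm. 16 (p. 397)] [cite: Delbourgo2002, Theorem (B) (p. 40)] [cite: GreenbergLNM1716, Prop. 4.14 (§4)] -/
theorem ClassX3M.bsdp_three_iff_padicVal_rankOne_of_wuthrichHalf_of_firstUnitIndex_of_multCoeffValAt_of_prop414_of_residualSurj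
    [Fact (Nat.Prime 3)] {W : WeierstrassCurve ℚ} [W.IsElliptic] [W.IsGloballyMinimal]
    (hW16 : Wuthrich2014.thm16_halfEigenCharIdeal_dvd_cyclotomicPrime)
    (h414 : Greenberg1999.prop414_noFiniteSubmodule_of_not_dvd_torsionOrder)
    (hmodD : nonempty_modularParametrizationData)
    (hGZK : rank_eq_analyticRank_of_analyticRank_le_one) (hmod : hasEntireLFunction_rat)
    (hX : ClassX3M W 3) (hr : W.analyticRank = 1) (htors : ¬ 3 ∣ W.torsionOrder) {n₀ : ℕ}
    (hrec : MultOddFirstUnitIndexAt W 3 n₀) (hres : ResidualSelmerRankGeAt 3 W n₀) {v₁ : ℤ}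
    (hv : MultCoeffValAt W 3 1 v₁) {Dh : PAdicHeightData W 3} (hB : LeadingTermClauses W 3 Dh)
    {q : ℚ} (hLq : W.leadingLCoeff = (q : ℂ) * (W.realPeriodRat : ℂ) * (W.regulator : ℂ)) :
    BSDp W 3 ↔ padicValRat 3 q + (padicRegulator Dh).valuation = 1 + v₁ :=
  hX.bsdp_iff_padicVal_rankOne_of_wuthrichHalf_of_firstUnitIndex_of_multCoeffValAt_of_prop414_of_residualSurj
    hW16 h414 hmodD hGZK hmod hr htors ⟨fun h ↦ absurd h (by norm_num), fun _ ↦ hrec⟩ hres hv hB hLq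

end Summit.BirchSwinnertonDyer.Rank1Residual.AdditivePotMult

end
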